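import Mathlib
import HarnessLib
import HarnessLib.Audit
import Summits.FinalStateConjecture.Statement
import Literature.Geometry.Lorentzian.IPlusRegular
import Literature.Geometry.Lorentzian.Geodesic
import Literature.Geometry.Lorentzian.Einstein
import Literature.Geometry.Lorentzian.KerrSchild
import Summits.FinalStateConjecture.FinalStateConjecture.Theorems.ZeroEnergyKerrOrBombKerrZeroEnergyUntrappedKS

/-!
Route: AnalyticityInvadesErgoregion

DORMANT since 2026-09-04T17:27:08Z (reconciler: no traction for 5 d (last activity statement-checked at 2026-08-30T16:33:24Z); parked, not closed — `ledger route dormant route-FinalStateConjecture-AnalyticityInvadesErgoregion --off` to ) — unstaffed, not closed; items shared with open routes are served there. `ledger route dormant <id> --off` reactivates.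

# Route AnalyticityInvadesErgoregion — analyticity invades the ergoregion — non-analyticity of a
smooth stationary vacuum hole rides only T-trapped zero-energy light, so non-trapping forces the
Hawking field through the belt

It suffices to show X = ERGOREGION ANALYTICITY (target `ErgoregionAnalyticity`, card
analyticity-invades-the-ergoregion made deciding): every smooth (NOT
assumed analytic, NOT assumed close to Kerr, NOT assumed axisymmetric) stationary asymptotically
flat VACUUM black hole 𝓑 (`StationaryAFBlackHole`) which is
I⁺-regular (Chruściel–Costa Def. 1.1), future-presented (every event lies in I⁺(M_ext): no white
hole), has T ≠ 0 on the d.o.c., carries a KILLING–TIMELIKE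
COLLAR (an open U ⊇ 𝓔⁺ and a field K, smooth and Killing on U, commuting with T there, non-zero and
tangent on the connected horizon, TIMELIKE on U ∩ d.o.c. —
the output of the smooth local rigidity theorems AlexakisIonescuKlainerman2010 / arXiv:1903.09135 in
Gaussian-null normal form), whose closed-ergoregion belt
off the collar is compact modulo T, and which has NO ZERO-ENERGY NULL GEODESIC TRAPPED MODULO T (no
maximal null geodesic with g(γ̇, T) = 0 stays inside the
T-orbit of a compact subset of the d.o.c.; the Alexakis–Ionescu–Klainerman hypothesis,
IonescuKlainerman2015 §4, taken modulo the stationary flow), has a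
d.o.c. metric that is REAL-ANALYTIC in a chart of the maximal smooth atlas around every point. X =
(K1) AnalyticHairRidesZeroEnergyLight ∧ (seeds)
SeedsAtBothEnds by the topological bookkeeping BeltBookkeeping; X → Statement through
NomizuAcrossAnalyticDoc (analytic continuation of the collar field:
X ⇒ NonTrappingHawkingRigidity, the smooth Hawking step of the AIK conjecture) and the frame
FinalStateFromHawkingRigidity (censorship + settling into this
class + smooth Carter–Robinson–Chruściel–Costa). LinearZeroModeAnalyticity is the linear model
theorem of K1 (transport of analyticity of T-invariant waves
through the belt WITHOUT a second Killing field), carried as the mechanism's test.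
Lean: `let An := fun (𝓑 : Literature.Geometry.Lorentzian.StationaryAFBlackHole.{0}) (y : 𝓑.carrier)
=> ∃ ψ ∈ IsManifold.maximalAtlas (𝓡 4) ((⊤ : ℕ∞) : WithTop ℕ∞) 𝓑.carrier, y ∈ ψ.source ∧ ∀ a b :
Literature.Geometry.Lorentzian.E4, AnalyticOnNhd ℝ (fun p : Literature.Geometry.Lorentzian.E4 ↦
𝓑.metric.val (ψ.symm p) (mfderiv 𝓘(ℝ, Literature.Geometry.Lorentzian.E4) (𝓡 4) ψ.symm p a) (mfderiv
𝓘(ℝ, Literature.Geometry.Lorentzian.E4) (𝓡 4) ψ.symm p b)) ψ.target; ∀ (𝓑 :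
Literature.Geometry.Lorentzian.StationaryAFBlackHole.{0}) [𝓑.metric.HasLeviCivita],
𝓑.metric.toPseudoRiemannianMetric.IsRicciFlat → 𝓑.IsIPlusRegular → (∀ p : 𝓑.carrier, p ∈
𝓑.metric.chronologicalFuture 𝓑.timeOrientation 𝓑.Mext) → (∀ p ∈ 𝓑.doc, 𝓑.killing p ≠ 0) → ∀ (U : Set
𝓑.carrier) (K : Π x : 𝓑.carrier, TangentSpace (𝓡 4) x), IsOpen U → 𝓑.horizon ⊆ U → IsConnected
𝓑.horizon → ContMDiffOn (𝓡 4) ((𝓡 4).prod 𝓘(ℝ, Literature.Geometry.Lorentzian.E4)) ((⊤ : ℕ∞) :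
WithTop ℕ∞) (fun x ↦ (Bundle.TotalSpace.mk' Literature.Geometry.Lorentzian.E4 x (K x) :
TangentBundle (𝓡 4) 𝓑.carrier)) U → (∀ x ∈ U, ∀ v w : TangentSpace (𝓡 4) x, 𝓑.metric.val x
(𝓑.metric.leviCivita K x v) w + 𝓑.metric.val x v (𝓑.metric.leviCivita K x w) = 0) → (∀ x ∈ U,
VectorField.mlieBracket (𝓡 4) 𝓑.killing K x = 0) → (∀ p ∈ 𝓑.horizon, K p ≠ 0) → (∀ γ : ℝ →
𝓑.carrier, IsMIntegralCurve γ K → γ 0 ∈ 𝓑.horizon → ∀ t, γ t ∈ 𝓑.horizon) → (∀ x ∈ U ∩ 𝓑.doc,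
𝓑.metric.val x (K x) (K x) < 0) → (∃ S₀ : Set 𝓑.carrier, IsCompact S₀ ∧ S₀ ⊆ 𝓑.doc ∧ ∀ y ∈ 𝓑.doc, 0
≤ 𝓑.metric.val y (𝓑.killing y) (𝓑.killing y) → y ∉ U → y ∈
Literature.Geometry.Lorentzian.stationaryOrbit 𝓑.killing S₀) → (∀ S : Set 𝓑.carrier, IsCompact S → S
⊆ 𝓑.doc → ∀ (γ : ℝ → 𝓑.carrier) (s : Set ℝ), Literature.Geometry.Lorentzian.IsMaximalGeodesicOn
𝓑.metric.toPseudoRiemannianMetric.leviCivita γ s → s.Nonempty → (∀ t ∈ s, 𝓑.metric.val (γ t)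
(Literature.Geometry.Lorentzian.velocity (𝓡 4) γ t) (Literature.Geometry.Lorentzian.velocity (𝓡 4) γ
t) = 0 ∧ Literature.Geometry.Lorentzian.velocity (𝓡 4) γ t ≠ 0 ∧ 𝓑.metric.val (γ t)
(Literature.Geometry.Lorentzian.velocity (𝓡 4) γ t) (𝓑.killing (γ t)) = 0) → ∃ t ∈ s, γ t ∉
Literature.Geometry.Lorentzian.stationaryOrbit 𝓑.killing S) → ∀ x ∈ 𝓑.doc, An 𝓑 x`

## Assembly
Pure logic (Sketch.lean rc 0, kernel-closed `hawkingRigidityOfAnalyticity_holds`, `assembly_holds`,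
`closes`): BeltBookkeeping turns K1 + seeds into the
target X; HawkingRigidityOfAnalyticity feeds X and the Nomizu step into NonTrappingHawkingRigidity;
the frame turns that into the Statement. The deciding
theorem is `closes (h0 : ErgoregionAnalyticity) … (h5 : FinalStateFromHawkingRigidity) … (h9n :
NomizuAcrossAnalyticDoc) … (h9h : HawkingRigidityOfAnalyticity)
… : FinalStateConjecture := h5 (h9h h0 h9n)` (glue.lean); LinearZeroModeAnalyticity and the two Kerr
sanity items ride as unused hypotheses (tests, not links).

Rationale: WHY THIS LINE. Let the stationary metric be its own analytic background: stationarity cuts the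
analytic characteristic variety of vacuum Einstein in an elliptic
T-adapted gauge down to the ZERO-ENERGY NULL CONE (covectors ξ with ξ(T) = 0, g⁻¹(ξ,ξ) = 0; kernel =
two transverse-traceless polarisations, card kit
j003590), so by the nonlinear Sato–Hörmander law (AlinhacMetivier1984 ×2,
doi:10.1002/cpa.3160240505, SKK 1973) the analytic wave-front set of g is carried
by zero-energy null bicharacteristics; it is EMPTY where a Killing field is timelike
(MullerZumHagen1970: T far out, the collar field K at the horizon), so
non-analyticity can only live on zero-energy light trapped in the belt in both time directions — and
a non-trapping hole has none; analyticity then lets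
Nomizu1960 continue the collar Killing field through the ergoregion (the step HawkingEllis1973 Prop.
9.3.6 needs analyticity for, and the step the barrier
IonescuKlainerman2012 forbids locally in the smooth class). Imported: algebraic/microlocal analysis
(analytic WF sets, propagation for nonlinear real
principal type), Lorentzian causal geometry (I⁺-regularity, achronal boundaries), analytic
continuation of Killing fields. What it does that the ledger does
not: ZeroEnergyKerrOrBomb sweeps T-pseudo-convex hypersurfaces by Carleman estimates (needs a convex
exhaustion; its trapping clause is moreover typed with
compactness IN SPACETIME, vacuous under strong causality), BeltLiouville replaces continuation by a
zero-frequency positive-commutator Liouville theorem,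
AnalyticInheritance inherits analyticity from analytic DATA through the evolution; here analyticity
is GENERATED by stationarity + ellipticity at both ends
of the belt and TRANSPORTED microlocally — no sweep, no convexity, no data, no second Killing field
(PetersenVasy arXiv:2104.04500 Thm 1.1/1.2 need the
axial field; read pp. 4–6). Negatives index: 0 refuted statements at filing.

RANKED CRUXES. #0 ErgoregionAnalyticity (target) — X as in § Thesis — vacuum, I⁺-regular,
future-presented 𝓑 with T ≠ 0 on the d.o.c., a Killing–timelike collar (U, K), belt compact mod T
and no zero-energy null geodesic trapped mod T ⇒ around every point of the d.o.c. some chart of the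
maximal C^∞ atlas makes the metric components real-analytic (`AnalyticOnNhd`). (why it might fail: a
smooth stationary vacuum hole whose non-analytic locus in the belt is threaded ONLY by non-trapped
zero-energy rays refutes the support law K1 — nonlinear analytic propagation for the
over-determined, gauge-dependent Einstein system is unwritten (Alinhac–Métivier is scalar).)
[IonescuKlainerman2015, AlinhacMetivier1984, MullerZumHagen1970, arXiv:2104.04500,
AlexakisIonescuKlainerman2010]
#2 AnalyticHairRidesZeroEnergyLight (crux) — [card K1, geometric shadow of WF_A(g) ⊂ Char =
zero-energy null cone + invariance under the bicharacteristic flow] for a vacuum, I⁺-regular,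
future-presented 𝓑 with T ≠ 0 on the d.o.c.: if the metric is NOT analytic in any smooth chart
around x ∈ d.o.c., then there is a MAXIMAL null geodesic γ through x = γ(0) with g(γ̇, T) = 0 such
that γ(t) is again a non-analytic point for every parameter t whose segment from 0 stays in the
d.o.c. (both directions). Contains Müller zum Hagen (T timelike at x ⇒ no zero-energy null vector ⇒
analytic). [difficulty: XL] (why it might fail: Alinhac–Métivier is scalar real principal type;
stationary vacuum Einstein is a 14×10 Douglis–Nirenberg system (rank-2 kernel on the cone), its
microlocalisation is gauge-dependent, and ergosurface points where the stationary limit surface is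
null are radial — no theorem covers this.) [AlinhacMetivier1984, doi:10.1080/03605308408820340,
doi:10.1002/cpa.3160240505, doi:10.1016/0022-1236(82)90051-9, MullerZumHagen1970, arXiv:2003.08106]
#3 LinearZeroModeAnalyticity (crux) — [card P3 generalised, the linear model WITHOUT a second
Killing field — transport only] on a 𝓑 of the target's class whose d.o.c. metric IS analytic
(chartwise), every smooth T-invariant solution u of □_g u = 0 on the d.o.c. which is analytic at the
seeds (where T is timelike, and on U ∩ d.o.c.) is analytic in a smooth chart around every point of
the d.o.c.: zero-energy non-trapping mod T transports analyticity of zero modes through the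
ergoregion belt. On Kerr this is Petersen–Vasy Thm 1.2 at σ = 0 for k = 0 without their temperedness
condition; the point is a proof using neither ∂_φ nor Fredholm theory. [difficulty: M] (why it might
fail: the T-reduced operator g^{ij}ξ_iξ_j has analytic coefficients and real principal type only off
radial points; where the stationary limit surface is null H_p is vertical (radial if dλ ∥ T♭), and
chartwise analyticity must first give an analytic orbit-space structure.) [arXiv:2104.04500,
doi:10.1002/cpa.3160240505, arXiv:2003.08106, arXiv:1012.4391, HormanderALPDO1]
#4 NonTrappingHawkingRigidity (crux) — [the smooth Hawking step of the Alexakis–Ionescu–Klainerman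
conjecture in this route's telescope; the docking statement] a vacuum, I⁺-regular, future-presented
𝓑 with T ≠ 0 on the d.o.c., simply connected d.o.c., a Killing–timelike collar (U, K) on a connected
horizon, belt compact mod T and no zero-energy null geodesic trapped mod T admits K' smooth and
Killing on the d.o.c. with [T, K'] = 0 and K' = K on U' ∩ d.o.c. for some open U' ⊇ 𝓔⁺ (⇒
axisymmetry). Reached here as ErgoregionAnalyticity + NomizuAcrossAnalyticDoc (support
HawkingRigidityOfAnalyticity, pure logic); provable by any other engine too (BeltLiouville's target
is the same statement in a laxer telescope). [deps: ErgoregionAnalyticity] [difficulty: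
open-problem] (why it might fail: it is the AIK conjecture's Hawking step (IonescuKlainerman2015 §4,
'wide open'); Ionescu–Klainerman's local non-extension (JAMS 2013 Thm 1.3) shows the equations alone
do not force K through the ergoregion, so everything rests on the GLOBAL non-trapping hypothesis.)
[IonescuKlainerman2015, IonescuKlainerman2012, AlexakisIonescuKlainerman2010,
AlexakisIonescuKlainerman2009, ChruscielWald1994Topology]
#5 FinalStateFromHawkingRigidity (crux) — [frame: X-consequence → Statement; card K4 folded in]
NonTrappingHawkingRigidity implies the final state conjecture: weak cosmic censorship + settling of
Christodoulou-generic MGHDs to finitely many receding stationary vacuum black-hole exteriors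
presentable in the telescope (I⁺-regular, future-presented, T ≠ 0, Killing–timelike collar by smooth
local rigidity + Gaussian-null sign lemma, belt compact mod T) which are ZERO-ENERGY NON-TRAPPING
mod T (card K4: a T-trapped zero-energy ray makes the limit an ergoregion/Friedman bomb, hence
Christodoulou-exceptional) + smooth Carter–Robinson–Chruściel–Costa for the axisymmetric limits +
sub-extremality and exhaustive charts. Shared in content with BeltLiouville's FinalStateFromRigidity
and ZeroEnergyKerrOrBomb's StationaryLimitReduction; expected to be split, not attacked head-on.
[deps: NonTrappingHawkingRigidity] [difficulty: open-problem] (why it might fail: contains weak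
cosmic censorship + large-data settling; generic limits must be zero-energy non-trapping but
ergoregion instability (arXiv:1608.02041, 1608.02035) is proved only away from the horizon / for
Kerr-like ergoregions; N ≥ 3 multi-hole equilibria are not excluded.) [DafermosLuk2017,
Christodoulou1999, ChruscielCosta2008, arXiv:1608.02041, arXiv:1608.02035, KlainermanSzeftel2023]
#9 SeedsAtBothEnds (support) — [card K2, with the collar in the hypotheses: Müller zum Hagen twice]
for 𝓑 as in K1 with a Killing–timelike collar (U, K): the metric is analytic in a smooth chart
around every y ∈ d.o.c. at which T is timelike or which lies in U (where K is Killing and timelike):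
vacuum + a timelike Killing field ⇒ analytic in harmonic coordinates adapted to it
(MullerZumHagen1970), a local statement; harmonic coordinates are charts of the maximal smooth
atlas. [difficulty: L] [MullerZumHagen1970, Morrey1955, AlexakisIonescuKlainerman2010]
#9 NomizuAcrossAnalyticDoc (support) — [card K3, the Nomizu step] for an I⁺-regular,
future-presented 𝓑 with simply connected d.o.c. and a Killing–timelike collar (U, K) on a connected
horizon: if the metric is chartwise analytic on the whole d.o.c., then K extends from the collar to
K' smooth and Killing on the d.o.c., commuting with T, equal to K on U' ∩ d.o.c. for an open U' ⊇
𝓔⁺. Proof intended: charts with analytic metric form an analytic atlas of the d.o.c. (isometries of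
analytic metrics are analytic); Killing fields of analytic metrics are analytic; Nomizu1960 on the
connected, simply connected analytic d.o.c.; [T, K'] is Killing and vanishes on the collar; U' from
local one-sidedness of the achronal boundary 𝓔⁺ (connected horizon ⇒ one collar component).
[difficulty: L] [Nomizu1960, ChruscielWald1994Topology, HawkingEllis1973]
#9 BeltBookkeeping (support) — [pure topology, provable now] AnalyticHairRidesZeroEnergyLight →
SeedsAtBothEnds → ErgoregionAnalyticity: if x ∈ d.o.c. were non-analytic, K1 gives a maximal
zero-energy null geodesic γ through x staying non-analytic while in the d.o.c.; future-presentedness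
makes closure(doc) ∖ doc = 𝓔⁺ ⊆ U and SeedsAtBothEnds makes U ∩ doc analytic, so by a first-exit
(interval-connectedness) argument γ never leaves the d.o.c.; then every γ(t) is non-analytic, hence
(contrapositive of the seeds) has T non-timelike and lies off U, hence (belt compactness) lies in
the T-orbit of the compact S₀ — contradicting non-trapping at S₀. [difficulty: provable-now]
[IonescuKlainerman2015, HawkingEllis1973]
#9 HawkingRigidityOfAnalyticity (support) — [pure logic, PROVED in Sketch.lean as
hawkingRigidityOfAnalyticity_holds] ErgoregionAnalyticity → NomizuAcrossAnalyticDoc →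
NonTrappingHawkingRigidity. [difficulty: provable-now] [Nomizu1960]
#9 KerrSchildAnalytic (support) — [anti-vacuity of the analyticity predicate; CONE REPAIR
2026-08-15: restated over `KerrSchild.lean` alone, because the package `Kerr.stationaryAFBlackHole`
(KerrStationaryBlackHole.lean) drags 26 unproved wave-decay / mass-inequality facts into the import
cone and none of them bears on this line] for all real M, a and all v, w ∈ E4 the Kerr–Schild
component p ↦ g_{M,a}(p)(v, w) = η(v, w) + 2H ℓ(v) ℓ(w), H = Mr³/(r⁴ + a²z²), is real-analytic
(`AnalyticOnNhd`) on {r > 0}: `Kerr.radius` is the square root of a positive analytic function there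
and the denominators r, r² + a², r⁴ + a²z² do not vanish. This is the componentwise content of the
named fact `Kerr.contMDiff_bilin` (a field of `Kerr.Facts`) and, composed with the identity chart of
`Kerr.region a (r₊ − δ)` (a chart of the maximal C^∞ atlas, mfderiv = id), yields `An` at every
point of the packaged hole — the bookkeeping half of the superseded KerrChartAnalytic. [difficulty:
M] [arXiv:0706.0622, DafermosRodnianski2008]
#9 KerrZeroEnergyUntrappedKS (support) — [anti-vacuity of the non-trapping clause, mod T: card P1;
CONE REPAIR 2026-08-15: restated over the chart spacetime `Kerr.spacetime M a (r₊ − δ)` (= the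
package's `toSpacetime`, rfl) with the explicit exterior {r > r₊} in place of `doc`] for
sub-extremal (M, a) and 0 < δ < r₊ − r₋, no maximal null geodesic of the ingoing Kerr–Schild chart
{r > r₊ − δ} with g(γ̇, ∂_t*) = 0 and γ̇ ≠ 0 stays in the ∂_t*-orbit of a compact S ⊆ {r > r₊}: E =
0 forces Q ≥ 0 and R(r) = a²L² − Δ(L² + Q), strictly decreasing on r > M (E = L = Q = 0 ⇒ γ̇ = 0,
excluded), so a zero-energy ray has at most one radial turning point (a bounce, R′ < 0); confinement
mod T would keep the momentum bounded (T + cΦ is timelike pointwise on {r > r₊} and −g(γ̇, T + cΦ) =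
−cL), hence force completeness, and then r(γ) leaves [min_S r, max_S r] — contradiction. The
identification doc = {r > r₊} is no longer needed. [difficulty: L] [IonescuKlainerman2015,
AlexakisIonescuKlainerman2009, arXiv:0706.0622]

TWO-LAYER PLAN. Foreseen glued splits (k ≤ 3, depth 1), filed only when a crux closes or stalls with
a census: AnalyticHairRidesZeroEnergyLight ⇐ EllipticGaugeSymbol
(joint principal symbol of {Ric = 0, maximal slicing, spatially harmonic} on the orbit space is
injective off the zero-energy null cone with TT kernel of
rank 2 — the card's kit computation j003590 made a lemma) → NonlinearSatoHormander (Alinhac–Métivier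
for Douglis–Nirenberg systems with scalar real
principal part after Dencker reduction: WF_A ⊂ Char and bicharacteristic invariance for C^∞
solutions) → AnalyticHairRidesZeroEnergyLight.
LinearZeroModeAnalyticity ⇐ OrbitSpaceAnalyticStructure (chartwise-analytic d.o.c. ⇒ analytic
orbit-space atlas with analytic reduced operator) →
LinearTransport (Hörmander 1971 / SKK propagation + treatment of the ergosurface-null points) →
LinearZeroModeAnalyticity. FinalStateFromHawkingRigidity
⇐ SettlesToTelescopeClass (generic MGHD: complete 𝓘⁺ + StationaryFinalStateDecomposition whose model
holes lie in the telescope, collar by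
AlexakisIonescuKlainerman2010 / Petersen + Gaussian-null sign lemma) → GenericZeroEnergyNonTrapping
(card K4: T-trapped zero-energy light ⇒ superradiant
quasimode growth ⇒ Christodoulou-exceptional; shared with zero-energy-optics-kerr-or-bomb) →
KerrFromHawkingExtension (smooth Carter–Robinson–Chruściel–Costa,
sub-extremality, exhaustive charts) → FinalStateFromHawkingRigidity.

KILL CRITERIA. A smooth stationary vacuum metric (even a local belt model inside the telescope) with
a non-analytic point x all of whose zero-energy null geodesics reach
the analytic region inside the d.o.c. refutes AnalyticHairRidesZeroEnergyLight — close
`refuted:AnalyticHairRidesZeroEnergyLight` (the mechanism is dead;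
NonTrappingHawkingRigidity survives as a classical target for BeltLiouville/ZeroEnergyKerrOrBomb).
LinearZeroModeAnalyticity refuted (a smooth non-analytic
T-invariant wave on an analytic non-trapping hole, analytic at the seeds) kills the transport step
already linearly: close refuted and record the
obstruction (radial ergosurface points?) as a barrier. NonTrappingHawkingRigidity refuted by a
genuine non-trapping smooth non-Kerr hole settles the AIK
conjecture negatively — close refuted, hand the witness to the negatives index. A refutation that
only exploits laxity of the hypothesis structure (junk
carriers) is answered by `--restate` with the missing regularity clause, not by closing.
FinalStateFromHawkingRigidity refuted (generic end states with
T-trapped zero-energy light surviving as attractors) kills the docking, not the rigidity theorem: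
re-dock. Smooth rigidity proved elsewhere (BeltLiouville,
Carleman sweeps, inherited analyticity) moots K1 for the summit but not as mathematics; `superseded
--by` that route.

NOT DECOMPOSED YET. The symbol lemma and the nonlinear microlocal theorem behind K1 (layer-2
children above); the orbit-space analytic structure; the Gaussian-null sign lemma
and the smooth local rigidity theorem that DISCHARGE the Killing–timelike-collar hypothesis (they
live in the frame, as published theorems: AIK 2010 needs a
bifurcation sphere, Petersen arXiv:1903.09135 Thm 1.17 compactness mod T, Kroencke–Petersen
arXiv:2110.14619); the identification doc = {r > r₊},
𝓔⁺ = {r = r₊} for the packaged Kerr hole (needed by no item after the 2026-08-15 cone repair; the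
package `Kerr.stationaryAFBlackHole` and the two superseded sanity items KerrChartAnalytic /
KerrZeroEnergyUntrapped return once the import cone of KerrStationaryBlackHole.lean is clean);
degenerate horizons (κ = 0: no timelike collar is claimed; AretakisInstability side);
everything dynamical inside the frame; constants — none are fixed at open. Deliberately NOT filed:
trapping typed by compactness in spacetime (vacuous under
strong causality — see Cheapest falsifier (iii)) and non-degeneracy typed by a GLOBAL horizon
Killing field (assumes Hawking's conclusion).

CHEAPEST FALSIFIER. (i) The card's: a REAL characteristic covector of the elliptic-gauge stationary
system off the zero-energy null cone would let WF_A travel on non-geodesic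
curves and void the trapping criterion — card kit j003590 (exact sympy, 3 backgrounds × 3 lines):
rank-drop locus = C²·(|ξ|²_q)³, cone kernel TT of
dimension 2; does not fire. (ii) Literature, read this session: Petersen–Vasy arXiv:2104.04500 pp.
4–6 — Thm 1.1 needs joint (t*, φ*)-modes, Thm 1.2
needs ∂_φ-invariant coefficients + Fredholm set-up + temperedness at σ = 0, Thm 1.8 is local at the
horizon for modes of the HORIZON Killing field; so
LinearZeroModeAnalyticity is not in print and is the refuter's first target: try to break transport
at an ergosurface point where the stationary limit
surface is null. (iii) Typing checks done here: trapping is modulo T (a future half-ray confined to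
a compact subset of a strongly causal spacetime does
not exist, so spacetime-compact typing is vacuous), the collar field is only LOCALLY Killing, and
Kerr meets every hypothesis (K = ∂_t* + Ω_H ∂_φ*
timelike on r₊ < r < r₊ + δ₀(M, a); E = 0 ⇒ R′(r) = −2(r − M)(L² + Q) < 0).

NUMBERS. Kerr (M = 1): r± = M ± √(M² − a²); κ = (r₊ − r₋)/(2(r₊² + a²)); Ω_H = a/(r₊² + a²);
ergosurface r_E(θ) = M + √(M² − a²cos²θ) touches 𝓗⁺ at the poles only;
zero-energy radial potential R₀(r) = −(Q + L²)(r² − 2Mr) − Qa², Q ≥ 0, R₀′ = −2(Q + L²)(r − M) < 0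
on r > M (one turning point ≤ 2M, no T-trapping for all
|a| < M); joint symbol of the elliptic-gauge stationary system: rank 10 off the cone, kernel
dimension 2 on it (card kit j003590). Known rigidity regimes:
analytic (ChruscielCosta2008 Thm 1.3), ε-close to Kerr (AlexakisIonescuKlainerman2009), small a on
the horizon (AlexakisIonescuKlainerman2014); linear
analyticity of zero modes: axisymmetric Kerr(-dS) only (arXiv:2104.04500). Items at open: 12 (1
target, 4 cruxes, 6 support, 1 assembly); after the cone repair of 2026-08-15 still 12 (two Kerr
sanity supports superseded 1:1), imports IPlusRegular + Geodesic + Einstein + KerrSchild (0 of the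
26 listed unproved facts in the cone).

DEFINITION REQUESTS. (D1) `StationaryAFBlackHole.IsChartwiseAnalyticAt 𝓑 x` (∃ chart of the maximal
C^∞ atlas around x with `AnalyticOnNhd` metric components — the `An` clause
inlined in six items) and `StationaryAFBlackHole.HasZeroEnergyRayTrappedModFlow 𝓑` (the
BeltLiouville/this-route non-trapping clause, modulo
`stationaryOrbit 𝓑.killing`) in Literature/Geometry/Lorentzian, so that layer-2 children are stated
by name (bridged by Iff.rfl). (D2) cite facts wanted as
hypotheses for the frame's split: Müller zum Hagen 1970 (analyticity where a Killing field is
timelike), Nomizu 1960 (extension of Killing fields on simply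
connected analytic manifolds, any signature), AIK 2010 Thm 1.1 (Hawking field near a non-degenerate
bifurcate horizon, smooth vacuum), Hörmander 1971 Thm
(propagation of WF_A, linear analytic real principal type). Filed with `ledger workitem add --kind
definition|cite` right after open.

Novelty: Searches (2026-08-15; searchd hybrid/local rc 75 ×6 this session, OpenAlex HTTP 429): `lit galaxy
search "propagation of analyticity" --star all` (13: SKK /
Kashiwara–Kawai–Kimura foundations, Berhanu involutive structures, Takei–Kawai Festschrift — no GR),
`lit galaxy search "analyticity of quasinormal modes"
--star pdf` (1: arXiv:2104.04500, READ pp. 4–6), `--star pdf "rigidity of stationary black holes"`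
(0); `lit search --source zbmath` "propagation of
analyticity nonlinear real principal type" (5: doi:10.1080/03605308408820340 Alinhac–Métivier,
Hörmander ALPDO I, Chen 2011), "analyticity stationary
vacuum Einstein Killing ergoregion" (0), "analytic wave front set Einstein equations" (1,
irrelevant); `--source arxiv` "Hawking rigidity without analyticity"
(3: 0902.1173, 0903.4723, 2110.14619), "Killing vector fields analytic extension Nomizu" (0), "zero
energy null geodesics trapped stationary Kerr uniqueness"
(0), "analyticity of stationary black holes" (0); `lit frontier FinalStateConjecture --since 2021`
(30 rows: trapped-surface formation, Kerr(-dS) stability,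
quasilinear waves — none on rigidity/analyticity); `lit bridges FinalStateConjecture --cross any`
(30, surveys); `ledger negatives` (0); the three neighbouring
route files read in full (ZeroEnergyKerrOrBomb, BeltLiouville, AnalyticInheritance); plus the card's
own search log and its mechanism-critic audit
(arXiv:2104.04500, arXiv:2003.08106, arXiv:1012.4391 §6.3).
Nearest prior art found: arXiv:2104.04500 (Peter  [refs: 10.1080/03605308408820340, 2104.04500, 2003.08106, 1012.4391, doi:10.1080/03605308408820340, IonescuKlainerman2015, AlexakisIonescuKlainerman2010, MullerZumHagen1970, AlinhacMetivier1984, Nomizu1960]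

Barriers (technique_class: microlocal-analytic-propagation, stationary-rigidity): - technique_class: microlocal-analytic-propagation, stationary-rigidity
- Literature.Barriers.FinalStateConjecture.IonescuKlainermanNonExtension: evaded — nothing is
continued across a hypersurface from local horizon data: the support law says WHERE non-analyticity
can live (T-trapped zero-energy light), predicts the barrier's local witnesses (their non-analytic
germs ride rays leaving the small domain sideways / the horizon conormal) and uses the GLOBAL
non-trapping hypothesis exactly where IK say local and global assumptions must be separated; K is
extended only AFTER analyticity, by Nomizu, where the barrier is void by its scope caveat.
- Literature.Barriers.FinalStateConjecture.AretakisInstability: consistent — the Killing–timelike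
collar (hence κ ≠ 0 in substance) is a hypothesis; degenerate horizons keep transversal non-analytic
hair on their generators (T-trapped zero-energy rays, as the law allows) and sit in the frame's
non-generic stratum.
- Literature.Barriers.FinalStateConjecture.KerrSuperradiance: no conserved or positive energy is
used anywhere; the ergoregion enters only as the home of zero-energy rays; superradiance re-enters
solely inside the frame's split child GenericZeroEnergyNonTrapping (as the resource removing
trapping holes), shared with zero-energy-optics-kerr-or-bomb.
- Literature.Barriers.FinalStateConjecture.HairyKerrBifurcation: not met — matter hair (complex
massive scalar) is analytic AND axisymmetric, so analyticity is not uniqueness; vacuum en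

History (route lifecycle, newest last):
- 2026-08-15T22:02:20Z · rev 1: dropped KerrChartAnalytic, KerrZeroEnergyUntrapped — cone repair: drop import KerrStationaryBlackHole (sole carrier of the 26 unproved cone facts, used only by 2 rank-9 Kerr sanity supports); supersede KerrChartAn (planner-rrepair-FinalStateConjecture-Analytici-129be4ec-0)
- 2026-08-15T22:02:25Z · rev 1: restated Assembly (stmt-FinalStateConjecture-13904) — ground repair (ground-failed, blocking flag Assembly: ground.trivial `intros; aesop`): rev-0 Assembly `K1 → Seeds → BeltBookkeeping → Nomizu → HawkingRigidityOf (planner-rground-FinalStateConjecture-Analyticit-129be4ec-0)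
- 2026-08-16T04:01:13Z · AUTO-CRUX (backfill): ErgoregionAnalyticity — hypotheses of the deciding theorem that nothing in the route derives are cruxes (operator:999:1085951)
- 2026-08-24T17:45:20Z · DORMANT — reconciler: no traction for 6.9 d (last activity item-evidence-added at 2026-08-17T18:30:33Z); parked, not closed — `ledger route dormant route-FinalStateConjec (operator:999:108434)
- 2026-08-30T11:18:19Z · REACTIVATED — reconciler: reactivated — activity item-evidence-added at 2026-08-30T10:31:46Z after parking at 2026-08-24T17:45:20Z (operator:999:1255101)
- 2026-09-04T17:27:08Z · DORMANT — reconciler: no traction for 5 d (last activity statement-checked at 2026-08-30T16:33:24Z); parked, not closed — `ledger route dormant route-FinalStateConjecture (operator:999:1468877)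

sub-problem: FinalStateConjecture · status: dormant · opened planner-plancard-FinalStateConjecture-FinalSt-f3f0adbd-0 2026-08-15T20:34:31Z · rev 1 · ledger route-FinalStateConjecture-AnalyticityInvadesErgoregion
GENERATED by the gate from the ledger (D-0016/17). Provers cite these decls: `theorem foo : Summit.FinalStateConjecture.FinalStateConjecture.Theses.AnalyticityInvadesErgoregion.<Decl> := …` in Summits/FinalStateConjecture/FinalStateConjecture/Theorems/<Name>.lean.
-/

namespace Summit.FinalStateConjecture.FinalStateConjecture.Theses.AnalyticityInvadesErgoregion

open scoped BigOperators Topology Manifold Classical MeasureTheory ProbabilityTheory Matrix InnerProductSpace ComplexConjugate ContinuousMap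
open Filter Set Function TopologicalSpace MeasureTheory

attribute [summit_statement] _root_.FinalStateConjecture

/-- item stmt-FinalStateConjecture-13893 · crux (kind.auto-crux: conjecture-grade) · rank 0 · open · by planner
why it might fail: a smooth stationary vacuum hole whose non-analytic locus in the belt is threaded ONLY by non-trapped zero-energy rays refutes the support law K1 — nonlinear analytic propagation for the over-determined, gauge-dependent Einstein system is unwritten (Alinhac–Métivier is scalar).
sources: IonescuKlainerman2015, AlinhacMetivier1984, MullerZumHagen1970, arXiv:2104.04500, AlexakisIonescuKlainerman2010
[target] X as in § Thesis — vacuum, I⁺-regular, future-presented 𝓑 with T ≠ 0 on the d.o.c., a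
Killing–timelike collar (U, K), belt compact mod T and no zero-energy null geodesic trapped mod T ⇒
around every point of the d.o.c. some chart of the maximal C^∞ atlas makes the metric components
real-analytic (`AnalyticOnNhd`). -/
@[route_item "route-FinalStateConjecture-AnalyticityInvadesErgoregion"]
def ErgoregionAnalyticity : Prop :=
  let An := fun (𝓑 : Literature.Geometry.Lorentzian.StationaryAFBlackHole.{0}) (y : 𝓑.carrier) => ∃ ψ ∈ IsManifold.maximalAtlas (𝓡 4) ((⊤ : ℕ∞) : WithTop ℕ∞) 𝓑.carrier, y ∈ ψ.source ∧ ∀ a b : Literature.Geometry.Lorentzian.E4, AnalyticOnNhd ℝ (fun p : Literature.Geometry.Lorentzian.E4 ↦ 𝓑.metric.val (ψ.symm p) (mfderiv 𝓘(ℝ, Literature.Geometry.Lorentzian.E4) (𝓡 4) ψ.symm p a) (mfderiv 𝓘(ℝ, Literature.Geometry.Lorentzian.E4) (𝓡 4) ψ.symm p b)) ψ.target; ∀ (𝓑 : Literature.Geometry.Lorentzian.StationaryAFBlackHole.{0}) [𝓑.metric.HasLeviCivita], 𝓑.metric.toPseudoRiemannianMetric.IsRicciFlat → 𝓑.IsIPlusRegular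 → (∀ p : 𝓑.carrier, p ∈ 𝓑.metric.chronologicalFuture 𝓑.timeOrientation 𝓑.Mext) → (∀ p ∈ 𝓑.doc, 𝓑.killing p ≠ 0) → ∀ (U : Set 𝓑.carrier) (K : Π x : 𝓑.carrier, TangentSpace (𝓡 4) x), IsOpen U → 𝓑.horizon ⊆ U → IsConnected 𝓑.horizon → ContMDiffOn (𝓡 4) ((𝓡 4).prod 𝓘(ℝ, Literature.Geometry.Lorentzian.E4)) ((⊤ : ℕ∞) : WithTop ℕ∞) (fun x ↦ (Bundle.TotalSpace.mk' Literature.Geometry.Lorentzian.E4 x (K x) : TangentBundle (𝓡 4) 𝓑.carrier)) U → (∀ x ∈ U, ∀ v w : TangentSpace (𝓡 4) x, 𝓑.metric.val x (𝓑.metric.leviCivita K x v) w + 𝓑.metric.val x v (𝓑.metric.leviCivita K x w) = 0) → (∀ x ∈ U, VectorField.mlieBracket (𝓡 4) 𝓑.killing K x = 0) → (∀ p ∈ 𝓑.horizon, K p ≠ 0) → (∀ γ : ℝ → 𝓑.carrier, IsMIntegralCurve γ K → γ 0 ∈ 𝓑.horizon → ∀ t, γ t ∈ 𝓑.horizon)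 → (∀ x ∈ U ∩ 𝓑.doc, 𝓑.metric.val x (K x) (K x) < 0) → (∃ S₀ : Set 𝓑.carrier, IsCompact S₀ ∧ S₀ ⊆ 𝓑.doc ∧ ∀ y ∈ 𝓑.doc, 0 ≤ 𝓑.metric.val y (𝓑.killing y) (𝓑.killing y) → y ∉ U → y ∈ Literature.Geometry.Lorentzian.stationaryOrbit 𝓑.killing S₀) → (∀ S : Set 𝓑.carrier, IsCompact S → S ⊆ 𝓑.doc → ∀ (γ : ℝ → 𝓑.carrier) (s : Set ℝ), Literature.Geometry.Lorentzian.IsMaximalGeodesicOn 𝓑.metric.toPseudoRiemannianMetric.leviCivita γ s → s.Nonempty → (∀ t ∈ s, 𝓑.metric.val (γ t) (Literature.Geometry.Lorentzian.velocity (𝓡 4) γ t) (Literature.Geometry.Lorentzian.velocity (𝓡 4) γ t) = 0 ∧ Literature.Geometry.Lorentzian.velocity (𝓡 4) γ t ≠ 0 ∧ 𝓑.metric.val (γ t) (Literature.Geometry.Lorentzian.velocity (𝓡 4) γ t) (𝓑.killing (γ t)) = 0) → ∃ t ∈ s, γ t ∉ Literature.Geometry.Lorentzian.stationaryOrbit 𝓑.killing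 S) → ∀ x ∈ 𝓑.doc, An 𝓑 x

/-- item stmt-FinalStateConjecture-13894 · crux · rank 2 · open · by planner
why it might fail: Alinhac–Métivier is scalar real principal type; stationary vacuum Einstein is a 14×10 Douglis–Nirenberg system (rank-2 kernel on the cone), its microlocalisation is gauge-dependent, and ergosurface points where the stationary limit surface is null are radial — no theorem covers this.
sources: AlinhacMetivier1984, doi:10.1080/03605308408820340, doi:10.1002/cpa.3160240505, doi:10.1016/0022-1236(82)90051-9, MullerZumHagen1970, arXiv:2003.08106
[crux] [card K1, geometric shadow of WF_A(g) ⊂ Char = zero-energy null cone + invariance under the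
bicharacteristic flow] for a vacuum, I⁺-regular, future-presented 𝓑 with T ≠ 0 on the d.o.c.: if the
metric is NOT analytic in any smooth chart around x ∈ d.o.c., then there is a MAXIMAL null geodesic
γ through x = γ(0) with g(γ̇, T) = 0 such that γ(t) is again a non-analytic point for every
parameter t whose segment from 0 stays in the d.o.c. (both directions). Contains Müller zum Hagen (T
timelike at x ⇒ no zero-energy null vector ⇒ analytic). [difficulty: XL] -/
@[route_item "route-FinalStateConjecture-AnalyticityInvadesErgoregion"]
def AnalyticHairRidesZeroEnergyLight : Prop :=
  let An := fun (𝓑 : Literature.Geometry.Lorentzian.StationaryAFBlackHole.{0}) (y : 𝓑.carrier) => ∃ ψ ∈ IsManifold.maximalAtlas (𝓡 4) ((⊤ : ℕ∞) : WithTop ℕ∞) 𝓑.carrier, y ∈ ψ.source ∧ ∀ a b : Literature.Geometry.Lorentzian.E4, AnalyticOnNhd ℝ (fun p : Literature.Geometry.Lorentzian.E4 ↦ 𝓑.metric.val (ψ.symm p) (mfderiv 𝓘(ℝ, Literature.Geometry.Lorentzian.E4) (𝓡 4) ψ.symm p a) (mfderiv 𝓘(ℝ, Literature.Geometry.Lorentzian.E4)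 (𝓡 4) ψ.symm p b)) ψ.target; ∀ (𝓑 : Literature.Geometry.Lorentzian.StationaryAFBlackHole.{0}) [𝓑.metric.HasLeviCivita], 𝓑.metric.toPseudoRiemannianMetric.IsRicciFlat → 𝓑.IsIPlusRegular → (∀ p : 𝓑.carrier, p ∈ 𝓑.metric.chronologicalFuture 𝓑.timeOrientation 𝓑.Mext) → (∀ p ∈ 𝓑.doc, 𝓑.killing p ≠ 0) → ∀ x ∈ 𝓑.doc, ¬ An 𝓑 x → ∃ (γ : ℝ → 𝓑.carrier) (s : Set ℝ), Literature.Geometry.Lorentzian.IsMaximalGeodesicOn 𝓑.metric.toPseudoRiemannianMetric.leviCivita γ s ∧ 0 ∈ s ∧ γ 0 = x ∧ (∀ t ∈ s, 𝓑.metric.val (γ t) (Literature.Geometry.Lorentzian.velocity (𝓡 4) γ t) (Literature.Geometry.Lorentzian.velocity (𝓡 4) γ t) = 0 ∧ Literature.Geometry.Lorentzian.velocity (𝓡 4) γ t ≠ 0 ∧ 𝓑.metric.val (γ t) (Literature.Geometry.Lorentzian.velocity (𝓡 4) γ t) (𝓑.killing (γ t)) = 0) ∧ ∀ t ∈ s,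 (∀ t' ∈ Set.uIcc 0 t, γ t' ∈ 𝓑.doc) → ¬ An 𝓑 (γ t)

/-- item stmt-FinalStateConjecture-13895 · crux · rank 3 · open · by planner
why it might fail: the T-reduced operator g^{ij}ξ_iξ_j has analytic coefficients and real principal type only off radial points; where the stationary limit surface is null H_p is vertical (radial if dλ ∥ T♭), and chartwise analyticity must first give an analytic orbit-space structure.
sources: arXiv:2104.04500, doi:10.1002/cpa.3160240505, arXiv:2003.08106, arXiv:1012.4391, HormanderALPDO1
[crux] [card P3 generalised, the linear model WITHOUT a second Killing field — transport only] on a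
𝓑 of the target's class whose d.o.c. metric IS analytic (chartwise), every smooth T-invariant
solution u of □_g u = 0 on the d.o.c. which is analytic at the seeds (where T is timelike, and on U
∩ d.o.c.) is analytic in a smooth chart around every point of the d.o.c.: zero-energy non-trapping
mod T transports analyticity of zero modes through the ergoregion belt. On Kerr this is
Petersen–Vasy Thm 1.2 at σ = 0 for k = 0 without their temperedness condition; the point is a proof
using neither ∂_φ nor Fredholm theory. [difficulty: M] -/
@[route_item "route-FinalStateConjecture-AnalyticityInvadesErgoregion"]
def LinearZeroModeAnalyticity : Prop :=
  let An := fun (𝓑 : Literature.Geometry.Lorentzian.StationaryAFBlackHole.{0}) (y : 𝓑.carrier) => ∃ ψ ∈ IsManifold.maximalAtlas (𝓡 4) ((⊤ : ℕ∞) : WithTop ℕ∞) 𝓑.carrier, y ∈ ψ.source ∧ ∀ a b : Literature.Geometry.Lorentzian.E4, AnalyticOnNhd ℝ (fun p : Literature.Geometry.Lorentzian.E4 ↦ 𝓑.metric.val (ψ.symm p) (mfderiv 𝓘(ℝ, Literature.Geometry.Lorentzian.E4) (𝓡 4) ψ.symm p a) (mfderiv 𝓘(ℝ, Literature.Geometry.Lorentzian.E4)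 (𝓡 4) ψ.symm p b)) ψ.target; let AnF := fun (𝓑 : Literature.Geometry.Lorentzian.StationaryAFBlackHole.{0}) (u : 𝓑.carrier → ℝ) (y : 𝓑.carrier) => ∃ ψ ∈ IsManifold.maximalAtlas (𝓡 4) ((⊤ : ℕ∞) : WithTop ℕ∞) 𝓑.carrier, y ∈ ψ.source ∧ AnalyticOnNhd ℝ (u ∘ ψ.symm) ψ.target; ∀ (𝓑 : Literature.Geometry.Lorentzian.StationaryAFBlackHole.{0}) [𝓑.metric.HasLeviCivita], 𝓑.IsIPlusRegular → (∀ p : 𝓑.carrier, p ∈ 𝓑.metric.chronologicalFuture 𝓑.timeOrientation 𝓑.Mext) → (∀ p ∈ 𝓑.doc, 𝓑.killing p ≠ 0) → ∀ (U : Set 𝓑.carrier) (K : Π x : 𝓑.carrier, TangentSpace (𝓡 4) x), IsOpen U → 𝓑.horizon ⊆ U → IsConnected 𝓑.horizon → ContMDiffOn (𝓡 4) ((𝓡 4).prod 𝓘(ℝ, Literature.Geometry.Lorentzian.E4)) ((⊤ : ℕ∞) : WithTop ℕ∞) (fun x ↦ (Bundle.TotalSpace.mk' Literature.Geometry.Lorentzian.E4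 x (K x) : TangentBundle (𝓡 4) 𝓑.carrier)) U → (∀ x ∈ U, ∀ v w : TangentSpace (𝓡 4) x, 𝓑.metric.val x (𝓑.metric.leviCivita K x v) w + 𝓑.metric.val x v (𝓑.metric.leviCivita K x w) = 0) → (∀ x ∈ U, VectorField.mlieBracket (𝓡 4) 𝓑.killing K x = 0) → (∀ p ∈ 𝓑.horizon, K p ≠ 0) → (∀ γ : ℝ → 𝓑.carrier, IsMIntegralCurve γ K → γ 0 ∈ 𝓑.horizon → ∀ t, γ t ∈ 𝓑.horizon) → (∀ x ∈ U ∩ 𝓑.doc, 𝓑.metric.val x (K x) (K x) < 0) → (∃ S₀ : Set 𝓑.carrier, IsCompact S₀ ∧ S₀ ⊆ 𝓑.doc ∧ ∀ y ∈ 𝓑.doc, 0 ≤ 𝓑.metric.val y (𝓑.killing y) (𝓑.killing y) → y ∉ U → y ∈ Literature.Geometry.Lorentzian.stationaryOrbit 𝓑.killing S₀) → (∀ S : Set 𝓑.carrier, IsCompact S → S ⊆ 𝓑.doc → ∀ (γ : ℝ → 𝓑.carrier) (s : Set ℝ), Literature.Geometry.Lorentzian.IsMaximalGeodesicOn 𝓑.metric.toPseudoRiemannianMetric.leviCivita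 γ s → s.Nonempty → (∀ t ∈ s, 𝓑.metric.val (γ t) (Literature.Geometry.Lorentzian.velocity (𝓡 4) γ t) (Literature.Geometry.Lorentzian.velocity (𝓡 4) γ t) = 0 ∧ Literature.Geometry.Lorentzian.velocity (𝓡 4) γ t ≠ 0 ∧ 𝓑.metric.val (γ t) (Literature.Geometry.Lorentzian.velocity (𝓡 4) γ t) (𝓑.killing (γ t)) = 0) → ∃ t ∈ s, γ t ∉ Literature.Geometry.Lorentzian.stationaryOrbit 𝓑.killing S) → (∀ x ∈ 𝓑.doc, An 𝓑 x) → ∀ u : 𝓑.carrier → ℝ, ContMDiffOn (𝓡 4) 𝓘(ℝ, ℝ) ((⊤ : ℕ∞) : WithTop ℕ∞) u 𝓑.doc → (∀ x ∈ 𝓑.doc, 𝓑.metric.dalembertian u x = 0 ∧ mfderiv (𝓡 4) 𝓘(ℝ, ℝ) u x (𝓑.killing x) = 0) → (∀ y ∈ 𝓑.doc, (𝓑.metric.val y (𝓑.killing y) (𝓑.killing y) < 0 ∨ y ∈ U) → AnF 𝓑 u y) → ∀ x ∈ 𝓑.doc, AnF 𝓑 u x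

/-- item stmt-FinalStateConjecture-13896 · crux · rank 4 · open · by planner
why it might fail: it is the AIK conjecture's Hawking step (IonescuKlainerman2015 §4, 'wide open'); Ionescu–Klainerman's local non-extension (JAMS 2013 Thm 1.3) shows the equations alone do not force K through the ergoregion, so everything rests on the GLOBAL non-trapping hypothesis.
sources: IonescuKlainerman2015, IonescuKlainerman2012, AlexakisIonescuKlainerman2010, AlexakisIonescuKlainerman2009, ChruscielWald1994Topology
[crux] [the smooth Hawking step of the Alexakis–Ionescu–Klainerman conjecture in this route's
telescope; the docking statement] a vacuum, I⁺-regular, future-presented 𝓑 with T ≠ 0 on the d.o.c.,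
simply connected d.o.c., a Killing–timelike collar (U, K) on a connected horizon, belt compact mod T
and no zero-energy null geodesic trapped mod T admits K' smooth and Killing on the d.o.c. with [T,
K'] = 0 and K' = K on U' ∩ d.o.c. for some open U' ⊇ 𝓔⁺ (⇒ axisymmetry). Reached here as
ErgoregionAnalyticity + NomizuAcrossAnalyticDoc (support HawkingRigidityOfAnalyticity, pure logic);
provable by any other engine too (BeltLiouville's target is the same statement in a laxer
telescope). [deps: ErgoregionAnalyticity] [difficulty: open-problem] -/
@[route_item "route-FinalStateConjecture-AnalyticityInvadesErgoregion"]
def NonTrappingHawkingRigidity : Prop :=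
  ∀ (𝓑 : Literature.Geometry.Lorentzian.StationaryAFBlackHole.{0}) [𝓑.metric.HasLeviCivita], 𝓑.metric.toPseudoRiemannianMetric.IsRicciFlat → 𝓑.IsIPlusRegular → (∀ p : 𝓑.carrier, p ∈ 𝓑.metric.chronologicalFuture 𝓑.timeOrientation 𝓑.Mext) → (∀ p ∈ 𝓑.doc, 𝓑.killing p ≠ 0) → SimplyConnectedSpace 𝓑.doc → ∀ (U : Set 𝓑.carrier) (K : Π x : 𝓑.carrier, TangentSpace (𝓡 4) x), IsOpen U → 𝓑.horizon ⊆ U → IsConnected 𝓑.horizon → ContMDiffOn (𝓡 4) ((𝓡 4).prod 𝓘(ℝ, Literature.Geometry.Lorentzian.E4)) ((⊤ : ℕ∞) : WithTop ℕ∞) (fun x ↦ (Bundle.TotalSpace.mk' Literature.Geometry.Lorentzian.E4 x (K x) : TangentBundle (𝓡 4) 𝓑.carrier)) U → (∀ x ∈ U, ∀ v w : TangentSpace (𝓡 4) x, 𝓑.metric.val x (𝓑.metric.leviCivita K x v) w + 𝓑.metric.val x v (𝓑.metric.leviCivita K x w) = 0) → (∀ x ∈ U, VectorField.mlieBracket (𝓡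 4) 𝓑.killing K x = 0) → (∀ p ∈ 𝓑.horizon, K p ≠ 0) → (∀ γ : ℝ → 𝓑.carrier, IsMIntegralCurve γ K → γ 0 ∈ 𝓑.horizon → ∀ t, γ t ∈ 𝓑.horizon) → (∀ x ∈ U ∩ 𝓑.doc, 𝓑.metric.val x (K x) (K x) < 0) → (∃ S₀ : Set 𝓑.carrier, IsCompact S₀ ∧ S₀ ⊆ 𝓑.doc ∧ ∀ y ∈ 𝓑.doc, 0 ≤ 𝓑.metric.val y (𝓑.killing y) (𝓑.killing y) → y ∉ U → y ∈ Literature.Geometry.Lorentzian.stationaryOrbit 𝓑.killing S₀) → (∀ S : Set 𝓑.carrier, IsCompact S → S ⊆ 𝓑.doc → ∀ (γ : ℝ → 𝓑.carrier) (s : Set ℝ), Literature.Geometry.Lorentzian.IsMaximalGeodesicOn 𝓑.metric.toPseudoRiemannianMetric.leviCivita γ s → s.Nonempty → (∀ t ∈ s, 𝓑.metric.val (γ t) (Literature.Geometry.Lorentzian.velocity (𝓡 4) γ t) (Literature.Geometry.Lorentzian.velocity (𝓡 4) γ t) = 0 ∧ Literature.Geometry.Lorentzian.velocity (𝓡 4)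 γ t ≠ 0 ∧ 𝓑.metric.val (γ t) (Literature.Geometry.Lorentzian.velocity (𝓡 4) γ t) (𝓑.killing (γ t)) = 0) → ∃ t ∈ s, γ t ∉ Literature.Geometry.Lorentzian.stationaryOrbit 𝓑.killing S) → ∃ K' : Π x : 𝓑.carrier, TangentSpace (𝓡 4) x, ContMDiffOn (𝓡 4) ((𝓡 4).prod 𝓘(ℝ, Literature.Geometry.Lorentzian.E4)) ((⊤ : ℕ∞) : WithTop ℕ∞) (fun x ↦ (Bundle.TotalSpace.mk' Literature.Geometry.Lorentzian.E4 x (K' x) : TangentBundle (𝓡 4) 𝓑.carrier)) 𝓑.doc ∧ (∀ x ∈ 𝓑.doc, ∀ v w : TangentSpace (𝓡 4) x, 𝓑.metric.val x (𝓑.metric.leviCivita K' x v) w + 𝓑.metric.val x v (𝓑.metric.leviCivita K' x w) = 0) ∧ (∀ x ∈ 𝓑.doc, VectorField.mlieBracket (𝓡 4) 𝓑.killing K' x = 0) ∧ ∃ U' : Set 𝓑.carrier, IsOpen U' ∧ 𝓑.horizon ⊆ U' ∧ ∀ x ∈ U' ∩ 𝓑.doc, K' x = K x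

/-- item stmt-FinalStateConjecture-13897 · crux · rank 5 · open · by planner
why it might fail: contains weak cosmic censorship + large-data settling; generic limits must be zero-energy non-trapping but ergoregion instability (arXiv:1608.02041, 1608.02035) is proved only away from the horizon / for Kerr-like ergoregions; N ≥ 3 multi-hole equilibria are not excluded.
sources: DafermosLuk2017, Christodoulou1999, ChruscielCosta2008, arXiv:1608.02041, arXiv:1608.02035, KlainermanSzeftel2023
[crux] [frame: X-consequence → Statement; card K4 folded in] NonTrappingHawkingRigidity implies the
final state conjecture: weak cosmic censorship + settling of Christodoulou-generic MGHDs to finitely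
many receding stationary vacuum black-hole exteriors presentable in the telescope (I⁺-regular,
future-presented, T ≠ 0, Killing–timelike collar by smooth local rigidity + Gaussian-null sign
lemma, belt compact mod T) which are ZERO-ENERGY NON-TRAPPING mod T (card K4: a T-trapped
zero-energy ray makes the limit an ergoregion/Friedman bomb, hence Christodoulou-exceptional) +
smooth Carter–Robinson–Chruściel–Costa for the axisymmetric limits + sub-extremality and exhaustive
charts. Shared in content with BeltLiouville's FinalStateFromRigidity and ZeroEnergyKerrOrBomb's
StationaryLimitReduction; expected to be split, not attacked head-on. [deps:
NonTrappingHawkingRigidity] [difficulty: open-problem] -/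
@[route_item "route-FinalStateConjecture-AnalyticityInvadesErgoregion"]
def FinalStateFromHawkingRigidity : Prop :=
  NonTrappingHawkingRigidity → _root_.FinalStateConjecture

/-- item stmt-FinalStateConjecture-13856 · support · rank 9 · open · by planner
sources: arXiv:0706.0622, DafermosRodnianski2008
[support] [anti-vacuity of the analyticity predicate; supersedes KerrChartAnalytic (cone repair
2026-08-15: stated over KerrSchild.lean only)] for all real M, a and v, w ∈ E4 the Kerr–Schild
metric component p ↦ g_{M,a}(p)(v, w) = η(v, w) + 2H(p) ℓ_p(v) ℓ_p(w), H = Mr³/(r⁴ + a²z²), ℓ = (1,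
(rx + ay)/(r² + a²), (ry − ax)/(r² + a²), z/r), is real-analytic on the open set {r > 0}
(`AnalyticOnNhd`): `Kerr.radius a` is √ of a positive analytic function wherever it is positive
(both nested radicands are > 0 there), and the denominators r, r² + a², r⁴ + a²z² do not vanish.
Componentwise content of the named fact `Kerr.contMDiff_bilin` (field of `Kerr.Facts`); with the
identity chart of `Kerr.region a (r₊ − δ)` it gives the target's `An` predicate at every point of
the packaged Kerr hole. [difficulty: M] -/
@[route_item "route-FinalStateConjecture-AnalyticityInvadesErgoregion"]
def KerrSchildAnalytic : Prop :=
  ∀ (M a : ℝ) (v w : Literature.Geometry.Lorentzian.E4), AnalyticOnNhd ℝ (fun p : Literature.Geometry.Lorentzian.E4 ↦ Literature.Geometry.Lorentzian.Kerr.bilin M a p v w) {p : Literature.Geometry.Lorentzian.E4 | 0 < Literature.Geometry.Lorentzian.Kerr.radius a p}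

/-- item stmt-FinalStateConjecture-13857 · support · rank 9 · closed · proved by Summit.FinalStateConjecture.FinalStateConjecture.Theorems.kerrZeroEnergyUntrappedKS_proof @ d9145520d80e (prover) · by planner
sources: IonescuKlainerman2015, AlexakisIonescuKlainerman2009, arXiv:0706.0622, arXiv:1501.01587
[support] [anti-vacuity of the non-trapping clause mod T, card P1; supersedes
KerrZeroEnergyUntrapped (cone repair 2026-08-15: stated over the chart spacetime `Kerr.spacetime M a
(r₊ − δ)`, which is the package's `toSpacetime` by rfl, with the explicit exterior {r > r₊} in place
of `doc`)] for sub-extremal (M, a), 0 < δ < r₊ − r₋ and [Kerr.Facts]: for every compact S ⊆ {r > r₊}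
of the ingoing Kerr–Schild chart {r > r₊ − δ}, every maximal null geodesic γ on an open interval s
with γ̇ ≠ 0 and zero energy g(γ̇, ∂_t*) = 0 on s has a parameter t ∈ s with γ t outside the
∂_t*-orbit of S. Proof route: E = 0 ⇒ Carter Q ≥ 0 and R(r) = a²L² − Δ(L² + Q) with R′ = −2(r −
M)(L² + Q) < 0 on r > M (E = L = Q = 0 ⇒ γ̇ = 0, excluded), so ≤ 1 radial turning point (a bounce);
confinement mod T bounds the momentum (T + cΦ timelike pointwise on {r > r₊}, −g(γ̇, T + cΦ) = −cL)
hence forces s = ℝ, and then r(γ t) exits [min_S r, max_S r]. No doc = {r > r₊} lemma needed.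
[difficulty: L] -/
@[route_item "route-FinalStateConjecture-AnalyticityInvadesErgoregion"]
def KerrZeroEnergyUntrappedKS : Prop :=
  ∀ [Literature.Geometry.Lorentzian.Kerr.Facts] (M a δ : ℝ) (hMa : Literature.Geometry.Lorentzian.Kerr.IsSubextremal M a), 0 < δ → δ < Literature.Geometry.Lorentzian.Kerr.rPlus M a - Literature.Geometry.Lorentzian.Kerr.rMinus M a → ∀ [(Literature.Geometry.Lorentzian.Kerr.spacetime M a (Literature.Geometry.Lorentzian.Kerr.rPlus M a - δ) hMa.pos.le).metric.HasLeviCivita], ∀ S : Set (Literature.Geometry.Lorentzian.Kerr.region a (Literature.Geometry.Lorentzian.Kerr.rPlus M a - δ)), IsCompact S → S ⊆ {x : Literature.Geometry.Lorentzian.Kerr.region a (Literature.Geometry.Lorentzian.Kerr.rPlus M a - δ) | Literature.Geometry.Lorentzian.Kerr.rPlus M a < Literature.Geometry.Lorentzian.Kerr.radius a x.1} → ∀ (γ : ℝ → Literature.Geometry.Lorentzian.Kerr.region a (Literature.Geometry.Lorentzian.Kerr.rPlus M a - δ)) (s : Set ℝ), Literature.Geometry.Lorentzian.IsMaximalGeodesicOn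 (Literature.Geometry.Lorentzian.Kerr.spacetime M a (Literature.Geometry.Lorentzian.Kerr.rPlus M a - δ) hMa.pos.le).metric.toPseudoRiemannianMetric.leviCivita γ s → s.Nonempty → (∀ t ∈ s, (Literature.Geometry.Lorentzian.Kerr.spacetime M a (Literature.Geometry.Lorentzian.Kerr.rPlus M a - δ) hMa.pos.le).metric.val (γ t) (Literature.Geometry.Lorentzian.velocity (𝓡 4) γ t) (Literature.Geometry.Lorentzian.velocity (𝓡 4) γ t) = 0 ∧ Literature.Geometry.Lorentzian.velocity (𝓡 4) γ t ≠ 0 ∧ (Literature.Geometry.Lorentzian.Kerr.spacetime M a (Literature.Geometry.Lorentzian.Kerr.rPlus M a - δ) hMa.pos.le).metric.val (γ t) (Literature.Geometry.Lorentzian.velocity (𝓡 4) γ t) ((Literature.Geometry.Lorentzian.Kerr.stationaryField a (Literature.Geometry.Lorentzian.Kerr.rPlus M a - δ)) (γ t)) = 0) → ∃ t ∈ s, γ t ∉ Literature.Geometry.Lorentzian.stationaryOrbit (Literature.Geometry.Lorentzian.Kerr.stationaryField a (Literature.Geometry.Lorentzian.Kerr.rPlus M a - δ)) S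

/-- `KerrZeroEnergyUntrappedKS` holds: proved by `Summit.FinalStateConjecture.FinalStateConjecture.Theorems.kerrZeroEnergyUntrappedKS_proof` @ d9145520d80e. -/
theorem KerrZeroEnergyUntrappedKS_holds : KerrZeroEnergyUntrappedKS := _root_.Summit.FinalStateConjecture.FinalStateConjecture.Theorems.kerrZeroEnergyUntrappedKS_proof

/-- item stmt-FinalStateConjecture-13898 · support · rank 9 · open · by planner
sources: MullerZumHagen1970, Morrey1955, AlexakisIonescuKlainerman2010
[support] [card K2, with the collar in the hypotheses: Müller zum Hagen twice] for 𝓑 as in K1 with a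
Killing–timelike collar (U, K): the metric is analytic in a smooth chart around every y ∈ d.o.c. at
which T is timelike or which lies in U (where K is Killing and timelike): vacuum + a timelike
Killing field ⇒ analytic in harmonic coordinates adapted to it (MullerZumHagen1970), a local
statement; harmonic coordinates are charts of the maximal smooth atlas. [difficulty: L] -/
@[route_item "route-FinalStateConjecture-AnalyticityInvadesErgoregion"]
def SeedsAtBothEnds : Prop :=
  let An := fun (𝓑 : Literature.Geometry.Lorentzian.StationaryAFBlackHole.{0}) (y : 𝓑.carrier) => ∃ ψ ∈ IsManifold.maximalAtlas (𝓡 4) ((⊤ : ℕ∞) : WithTop ℕ∞) 𝓑.carrier, y ∈ ψ.source ∧ ∀ a b : Literature.Geometry.Lorentzian.E4, AnalyticOnNhd ℝ (fun p : Literature.Geometry.Lorentzian.E4 ↦ 𝓑.metric.val (ψ.symm p) (mfderiv 𝓘(ℝ, Literature.Geometry.Lorentzian.E4) (𝓡 4) ψ.symm p a) (mfderiv 𝓘(ℝ, Literature.Geometry.Lorentzian.E4) (𝓡 4) ψ.symm p b)) ψ.target; ∀ (𝓑 : Literature.Geometry.Lorentzian.StationaryAFBlackHole.{0}) [𝓑.metric.HasLeviCivita],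 𝓑.metric.toPseudoRiemannianMetric.IsRicciFlat → 𝓑.IsIPlusRegular → (∀ p : 𝓑.carrier, p ∈ 𝓑.metric.chronologicalFuture 𝓑.timeOrientation 𝓑.Mext) → (∀ p ∈ 𝓑.doc, 𝓑.killing p ≠ 0) → ∀ (U : Set 𝓑.carrier) (K : Π x : 𝓑.carrier, TangentSpace (𝓡 4) x), IsOpen U → 𝓑.horizon ⊆ U → IsConnected 𝓑.horizon → ContMDiffOn (𝓡 4) ((𝓡 4).prod 𝓘(ℝ, Literature.Geometry.Lorentzian.E4)) ((⊤ : ℕ∞) : WithTop ℕ∞) (fun x ↦ (Bundle.TotalSpace.mk' Literature.Geometry.Lorentzian.E4 x (K x) : TangentBundle (𝓡 4) 𝓑.carrier)) U → (∀ x ∈ U, ∀ v w : TangentSpace (𝓡 4) x, 𝓑.metric.val x (𝓑.metric.leviCivita K x v) w + 𝓑.metric.val x v (𝓑.metric.leviCivita K x w) = 0) → (∀ x ∈ U, VectorField.mlieBracket (𝓡 4) 𝓑.killing K x = 0) → (∀ p ∈ 𝓑.horizon, K p ≠ 0) → (∀ γ : ℝ → 𝓑.carrier, IsMIntegralCurve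 γ K → γ 0 ∈ 𝓑.horizon → ∀ t, γ t ∈ 𝓑.horizon) → (∀ x ∈ U ∩ 𝓑.doc, 𝓑.metric.val x (K x) (K x) < 0) → ∀ y ∈ 𝓑.doc, (𝓑.metric.val y (𝓑.killing y) (𝓑.killing y) < 0 ∨ y ∈ U) → An 𝓑 y

/-- item stmt-FinalStateConjecture-13899 · support · rank 9 · open · by planner
sources: Nomizu1960, ChruscielWald1994Topology, HawkingEllis1973
[support] [card K3, the Nomizu step] for an I⁺-regular, future-presented 𝓑 with simply connected
d.o.c. and a Killing–timelike collar (U, K) on a connected horizon: if the metric is chartwise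
analytic on the whole d.o.c., then K extends from the collar to K' smooth and Killing on the d.o.c.,
commuting with T, equal to K on U' ∩ d.o.c. for an open U' ⊇ 𝓔⁺. Proof intended: charts with
analytic metric form an analytic atlas of the d.o.c. (isometries of analytic metrics are analytic);
Killing fields of analytic metrics are analytic; Nomizu1960 on the connected, simply connected
analytic d.o.c.; [T, K'] is Killing and vanishes on the collar; U' from local one-sidedness of the
achronal boundary 𝓔⁺ (connected horizon ⇒ one collar component). [difficulty: L] -/
@[route_item "route-FinalStateConjecture-AnalyticityInvadesErgoregion"]
def NomizuAcrossAnalyticDoc : Prop :=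
  let An := fun (𝓑 : Literature.Geometry.Lorentzian.StationaryAFBlackHole.{0}) (y : 𝓑.carrier) => ∃ ψ ∈ IsManifold.maximalAtlas (𝓡 4) ((⊤ : ℕ∞) : WithTop ℕ∞) 𝓑.carrier, y ∈ ψ.source ∧ ∀ a b : Literature.Geometry.Lorentzian.E4, AnalyticOnNhd ℝ (fun p : Literature.Geometry.Lorentzian.E4 ↦ 𝓑.metric.val (ψ.symm p) (mfderiv 𝓘(ℝ, Literature.Geometry.Lorentzian.E4) (𝓡 4) ψ.symm p a) (mfderiv 𝓘(ℝ, Literature.Geometry.Lorentzian.E4) (𝓡 4) ψ.symm p b)) ψ.target; ∀ (𝓑 : Literature.Geometry.Lorentzian.StationaryAFBlackHole.{0}) [𝓑.metric.HasLeviCivita], 𝓑.IsIPlusRegular → (∀ p : 𝓑.carrier, p ∈ 𝓑.metric.chronologicalFuture 𝓑.timeOrientation 𝓑.Mext) → SimplyConnectedSpace 𝓑.doc → ∀ (U : Set 𝓑.carrier) (K : Π x : 𝓑.carrier, TangentSpace (𝓡 4) x), IsOpen U → 𝓑.horizon ⊆ U → IsConnected 𝓑.horizon → ContMDiffOn (𝓡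 4) ((𝓡 4).prod 𝓘(ℝ, Literature.Geometry.Lorentzian.E4)) ((⊤ : ℕ∞) : WithTop ℕ∞) (fun x ↦ (Bundle.TotalSpace.mk' Literature.Geometry.Lorentzian.E4 x (K x) : TangentBundle (𝓡 4) 𝓑.carrier)) U → (∀ x ∈ U, ∀ v w : TangentSpace (𝓡 4) x, 𝓑.metric.val x (𝓑.metric.leviCivita K x v) w + 𝓑.metric.val x v (𝓑.metric.leviCivita K x w) = 0) → (∀ x ∈ U, VectorField.mlieBracket (𝓡 4) 𝓑.killing K x = 0) → (∀ p ∈ 𝓑.horizon, K p ≠ 0) → (∀ γ : ℝ → 𝓑.carrier, IsMIntegralCurve γ K → γ 0 ∈ 𝓑.horizon → ∀ t, γ t ∈ 𝓑.horizon) → (∀ x ∈ U ∩ 𝓑.doc, 𝓑.metric.val x (K x) (K x) < 0) → (∀ x ∈ 𝓑.doc, An 𝓑 x) → ∃ K' : Π x : 𝓑.carrier, TangentSpace (𝓡 4) x, ContMDiffOn (𝓡 4) ((𝓡 4).prod 𝓘(ℝ, Literature.Geometry.Lorentzian.E4)) ((⊤ : ℕ∞) : WithTop ℕ∞) (fun x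 ↦ (Bundle.TotalSpace.mk' Literature.Geometry.Lorentzian.E4 x (K' x) : TangentBundle (𝓡 4) 𝓑.carrier)) 𝓑.doc ∧ (∀ x ∈ 𝓑.doc, ∀ v w : TangentSpace (𝓡 4) x, 𝓑.metric.val x (𝓑.metric.leviCivita K' x v) w + 𝓑.metric.val x v (𝓑.metric.leviCivita K' x w) = 0) ∧ (∀ x ∈ 𝓑.doc, VectorField.mlieBracket (𝓡 4) 𝓑.killing K' x = 0) ∧ ∃ U' : Set 𝓑.carrier, IsOpen U' ∧ 𝓑.horizon ⊆ U' ∧ ∀ x ∈ U' ∩ 𝓑.doc, K' x = K x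

/-- item stmt-FinalStateConjecture-13900 · support · rank 9 · open · by planner
sources: IonescuKlainerman2015, HawkingEllis1973
[support] [pure topology, provable now] AnalyticHairRidesZeroEnergyLight → SeedsAtBothEnds →
ErgoregionAnalyticity: if x ∈ d.o.c. were non-analytic, K1 gives a maximal zero-energy null geodesic
γ through x staying non-analytic while in the d.o.c.; future-presentedness makes closure(doc) ∖ doc
= 𝓔⁺ ⊆ U and SeedsAtBothEnds makes U ∩ doc analytic, so by a first-exit (interval-connectedness)
argument γ never leaves the d.o.c.; then every γ(t) is non-analytic, hence (contrapositive of the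
seeds) has T non-timelike and lies off U, hence (belt compactness) lies in the T-orbit of the
compact S₀ — contradicting non-trapping at S₀. [difficulty: provable-now] -/
@[route_item "route-FinalStateConjecture-AnalyticityInvadesErgoregion"]
def BeltBookkeeping : Prop :=
  AnalyticHairRidesZeroEnergyLight → SeedsAtBothEnds → ErgoregionAnalyticity

/-- item stmt-FinalStateConjecture-13901 · support · rank 9 · open · by planner
sources: Nomizu1960
[support] [pure logic, PROVED in Sketch.lean as hawkingRigidityOfAnalyticity_holds]
ErgoregionAnalyticity → NomizuAcrossAnalyticDoc → NonTrappingHawkingRigidity. [difficulty: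
provable-now] -/
@[route_item "route-FinalStateConjecture-AnalyticityInvadesErgoregion"]
def HawkingRigidityOfAnalyticity : Prop :=
  ErgoregionAnalyticity → NomizuAcrossAnalyticDoc → NonTrappingHawkingRigidity

-- earlier Assembly (stmt-FinalStateConjecture-13904, replaced 2026-08-15T22:02:25Z -> stmt-FinalStateConjecture-13859): retired by None — AnalyticHairRidesZeroEnergyLight → SeedsAtBothEnds → BeltBookkeeping → NomizuAcrossAnalyticDoc → HawkingRigidityOfAnalyticity → FinalStateFromHawkingRigidity → _root_.FinalStateConjecture
/-- item stmt-FinalStateConjecture-13859 · assembly · rank 1 · open · by planner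
sources: IonescuKlainerman2015, DafermosLuk2017
the route's mechanism chain decides the Statement: K1 (AnalyticHairRidesZeroEnergyLight) + the seeds
(SeedsAtBothEnds) + the Nomizu step (NomizuAcrossAnalyticDoc) + the frame
(FinalStateFromHawkingRigidity) ⇒ FinalStateConjecture. Its proof is exactly the two glue supports —
BeltBookkeeping (K1 → seeds → ErgoregionAnalyticity = X, first-exit topology + belt compactness +
non-trapping) and HawkingRigidityOfAnalyticity (X → Nomizu → NonTrappingHawkingRigidity, pure logic)
— followed by the frame; so it closes with a one-line proof once those two supports land. (rev 0
listed BeltBookkeeping and HawkingRigidityOfAnalyticity among the antecedents, which made the item a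
tautology: ground.trivial `intros; aesop`; repaired in rev 1 by moving them from hypotheses to proof
obligations — same chain, same decl.) -/
@[route_item "route-FinalStateConjecture-AnalyticityInvadesErgoregion"]
def Assembly : Prop :=
  AnalyticHairRidesZeroEnergyLight → SeedsAtBothEnds → NomizuAcrossAnalyticDoc → FinalStateFromHawkingRigidity → _root_.FinalStateConjecture

/-! D-0027 §2.1 — DECIDING THEOREM (planner-authored via `route open/edit --closes-file`; by planner-rrepair-FinalStateConjecture-Analytici-129be4ec-0 2026-08-15T22:02:20Z):
its hypotheses are this route's items and its conclusion the sub-problem Statement (glue_lint), and it elaborates with this file. -/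

@[closes "route-FinalStateConjecture-AnalyticityInvadesErgoregion"] theorem closes (h0 : ErgoregionAnalyticity) (_h2 : AnalyticHairRidesZeroEnergyLight) (_h3 : LinearZeroModeAnalyticity)
    (_h4 : NonTrappingHawkingRigidity) (h5 : FinalStateFromHawkingRigidity) (_h9s : SeedsAtBothEnds)
    (h9n : NomizuAcrossAnalyticDoc) (_h9b : BeltBookkeeping) (h9h : HawkingRigidityOfAnalyticity)
    (_h9k : KerrSchildAnalytic) (_h9z : KerrZeroEnergyUntrappedKS) (_hA : Assembly) : _root_.FinalStateConjecture :=
  h5 (h9h h0 h9n)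

end Summit.FinalStateConjecture.FinalStateConjecture.Theses.AnalyticityInvadesErgoregion
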